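import Mathlib.AlgebraicGeometry.Morphisms.Smooth
import Mathlib.AlgebraicGeometry.Morphisms.Flat
import Mathlib.AlgebraicGeometry.Morphisms.FinitePresentation
import Mathlib.AlgebraicGeometry.Morphisms.Proper
import Mathlib.AlgebraicGeometry.Morphisms.UniversallyOpen
import Mathlib.AlgebraicGeometry.Morphisms.Separated
import Mathlib.RingTheory.AdicCompletion.Algebra
import Mathlib.RingTheory.MvPowerSeries.Basic
import Mathlib.RingTheory.RegularLocalRing.Defs
import Mathlib.FieldTheory.IsAlgClosed.Basic
import HarnessLib

/-!
# Semi-stable curves and pointed semi-stable curves over a base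

Topic `Literature/AlgebraicGeometry/ModuliOfCurves`. A LEAF module (imports: Mathlib and
`HarnessLib` only) carrying the vocabulary of families of nodal curves that the moduli theory of
stable pointed curves (`ModuliOfCurves.StableCurvesModuliCover`: Deligne–Mumford 1969, Def. (1.1);
Knudsen 1983, Def. 1.1) is typed over:

* `IsOrdinaryDoublePoint K x` — the point `x` of a scheme `C` (in applications a closed point of
  a geometric fibre over the algebraically closed field `K`) is an **ordinary double point**: the
  completion of `𝒪_{C,x}` is isomorphic to `K⟦u, v⟧/(uv)` (de Jong 1996, 2.23); proved API: the
  ring `K⟦u, v⟧/(uv)` is not a domain, so a point whose local ring is a field is not an ordinary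
  double point;
* `IsSemiStableCurve f` — **semi-stable curve over a base** (de Jong 1996, 2.21: "a flat proper
  `f : X → S` of finite presentation, such that all geometric fibres are connected curves having
  at most ordinary double points as singularities"); proved API: universally open, separated,
  dominant over an irreducible base;
* `IsPointedSemiStableCurve p τ` — a semi-stable curve with `n` mutually disjoint sections into
  its smooth locus (the part of Knudsen's "stable `n`-pointed curve" that de Jong 1996, 4.23 uses:
  "`τᵢ`, `1 ≤ i ≤ n` are mutually disjoint sections into the smooth locus of `f`"); proved API:
  the sections are closed immersions (a section of a separated morphism is one), have closed
  images, and form an injective family over a non-empty base.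

Design note (import hygiene, route repair `HodgeConjecture/SaitoKurokawaBridge`, 2026-08-16). The
de Jong alteration chain renders the same three notions, with byte-identical bodies, as
`Literature.AlgebraicGeometry.Resolution.IsOrdinaryDoublePoint`,
`Literature.AlgebraicGeometry.Resolution.IsSemiStableCurve` (`Resolution/AlterationsSemiStable.lean`)
and `Literature.AlgebraicGeometry.Resolution.DeJong1996.IsPointedSemiStableCurve`
(`Resolution/AlterationsStableModel.lean`); those modules sit on top of the whole alteration
development (dozens of named facts: de Jong 1996, Thm. 4.1 and its decomposition, resolution of
singularities, …), so a consumer that only needs the DEFINITIONS must not import them. This file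
is that definition-only home; the gate's one-name-one-module rule forbids re-declaring the
`Resolution` names here, hence the `ModuliOfCurves` namespace. The equivalences with the
`Resolution` renderings hold by `Iff.rfl` / field-wise transport and belong in a bridge module
importing both sides (never here: this file stays Mathlib-only).

What is NOT here: arithmetic genus, Knudsen's stability condition, the moduli stacks — see
`ModuliOfCurves/StableCurvesModuliCover.lean`.

## References

* A. J. de Jong, *Smoothness, semi-stability and alterations*, Publ. Math. IHÉS 83 (1996) 51–93:
  2.21–2.23 (pp. 61–62), 4.23 (p. 75).
* P. Deligne, D. Mumford, *The irreducibility of the space of curves of given genus*, Publ.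
  Math. IHÉS 36 (1969) 75–109: Def. (1.1), p. 76.
* F. Knudsen, *The projectivity of the moduli space of stable curves II: the stacks `M_{g,n}`*,
  Math. Scand. 52 (1983) 161–199: Def. 1.1.
-/

noncomputable section

open CategoryTheory CategoryTheory.Limits AlgebraicGeometry TopologicalSpace

namespace Literature.AlgebraicGeometry.ModuliOfCurves

universe u

/-! ## Ordinary double points (de Jong 1996, 2.23) -/

/-- **Ordinary double point over an algebraically closed field** (de Jong 1996, 2.21 and 2.23):
the point `x` of the scheme `C` (in applications: a closed point of a geometric fibre, a scheme
of finite type over the algebraically closed field `K`) is an ordinary double point, i.e. the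
completion of its local ring is isomorphic to `K⟦u, v⟧/(uv)` — 2.23: "By assumption of
semi-stability we have that `B/𝔪_A B ≅ k'⟦u, v⟧/(q)`, where `q` is a quadratic form with
nonvanishing discriminant", and over an algebraically closed field every such `q` is equivalent
to `uv` (loc. cit.: "If `f` is split … we may choose `q = uv`"). The completion is Mathlib's
`AdicCompletion` of the stalk `𝒪_{C,x}` at its maximal ideal, `K⟦u, v⟧` is
`MvPowerSeries (Fin 2) K`; an isomorphism of rings is required (for a closed point of a scheme of
finite type over the algebraically closed `K` this is equivalent to a `K`-algebra isomorphism: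
both sides are then complete local `K`-algebras with residue field `K`, reduced with two
regular one-dimensional branches meeting transversally). Same body as
`Literature.AlgebraicGeometry.Resolution.IsOrdinaryDoublePoint` (see the module docstring).
[cite: DeJong1996, 2.23, pp. 61–62] -/
def IsOrdinaryDoublePoint (K : Type u) [Field K] {C : Scheme.{u}} (x : C) : Prop :=
  Nonempty
    (AdicCompletion (IsLocalRing.maximalIdeal (C.presheaf.stalk x)) (C.presheaf.stalk x) ≃+*
      MvPowerSeries (Fin 2) K ⧸
        Ideal.span {(MvPowerSeries.X 0 * MvPowerSeries.X 1 : MvPowerSeries (Fin 2) K)})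

namespace IsOrdinaryDoublePoint

/-- Distinct variables do not divide each other in a power series ring: the coefficient of `Xᵢ`
at the monomial `Xᵢ` is `1`, while every multiple of `Xⱼ` has coefficient `0` there.
[folklore] -/
theorem not_X_dvd_X_of_ne {σ : Type*} {R : Type*} [CommSemiring R] [Nontrivial R] {i j : σ}
    (h : i ≠ j) : ¬ (MvPowerSeries.X j : MvPowerSeries σ R) ∣ MvPowerSeries.X i := by
  classical
  intro hd
  have h0 := (MvPowerSeries.X_dvd_iff.mp hd) (Finsupp.single i 1)
    (by rw [Finsupp.single_apply, if_neg h])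
  rw [MvPowerSeries.coeff_index_single_self_X] at h0
  exact one_ne_zero h0

/-- The complete local ring `K⟦u, v⟧/(uv)` of an ordinary double point is not a domain:
`u · v = 0` while `u ≠ 0` and `v ≠ 0`. [folklore] -/
theorem not_isDomain_quotient (K : Type u) [Field K] :
    ¬ IsDomain (MvPowerSeries (Fin 2) K ⧸
      Ideal.span {(MvPowerSeries.X 0 * MvPowerSeries.X 1 : MvPowerSeries (Fin 2) K)}) := by
  set J : Ideal (MvPowerSeries (Fin 2) K) :=
    Ideal.span {(MvPowerSeries.X 0 * MvPowerSeries.X 1 : MvPowerSeries (Fin 2) K)} with hJ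
  intro hD
  have hne : ∀ {i j : Fin 2}, i ≠ j → Ideal.Quotient.mk J (MvPowerSeries.X i) ≠ 0 := by
    intro i j hij h0
    rw [Ideal.Quotient.eq_zero_iff_mem, hJ, Ideal.mem_span_singleton] at h0
    refine not_X_dvd_X_of_ne hij (dvd_trans ?_ h0)
    fin_cases j
    · exact dvd_mul_right _ _
    · exact dvd_mul_left _ _
  have hzero : Ideal.Quotient.mk J (MvPowerSeries.X 0) * Ideal.Quotient.mk J (MvPowerSeries.X 1) =
      0 := by
    rw [← map_mul, Ideal.Quotient.eq_zero_iff_mem, hJ]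
    exact Ideal.subset_span rfl
  rcases mul_eq_zero.mp hzero with h | h
  · exact hne (i := 0) (j := 1) (by decide) h
  · exact hne (i := 1) (j := 0) (by decide) h

/-- The `𝔪`-adic completion of a local ring which is a field is a domain (it is the field
itself, `𝔪 = 0`). [folklore] -/
theorem isDomain_adicCompletion_of_isField {R : Type u} [CommRing R] [IsLocalRing R]
    (hR : IsField R) : IsDomain (AdicCompletion (IsLocalRing.maximalIdeal R) R) := by
  have hm : IsLocalRing.maximalIdeal R = ⊥ := IsLocalRing.isField_iff_maximalIdeal_eq.mp hR
  haveI : IsAdicComplete (IsLocalRing.maximalIdeal R) R := by rw [hm]; infer_instance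
  haveI := hR.isDomain
  exact MulEquiv.isDomain R (AdicCompletion.ofAlgEquiv (IsLocalRing.maximalIdeal R)).symm.toMulEquiv

/-- A point whose local ring is a field (e.g. the generic point of an integral scheme) is not an
ordinary double point. [folklore] -/
theorem not_of_isField (K : Type u) [Field K] {C : Scheme.{u}} {x : C}
    (hx : IsField (C.presheaf.stalk x)) : ¬ IsOrdinaryDoublePoint K x := by
  rintro ⟨e⟩
  haveI := isDomain_adicCompletion_of_isField hx
  exact not_isDomain_quotient K (MulEquiv.isDomain _ e.symm.toMulEquiv)

end IsOrdinaryDoublePoint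

/-! ## Semi-stable curves over a base (de Jong 1996, 2.21) -/

/-- **Semi-stable curve over a base** (de Jong 1996, 2.21): "Let `S` be a scheme. A semi-stable
curve `X` over `S` is a flat proper `f : X → S` of finite presentation, such that all geometric
fibres are connected curves having at most ordinary double points as singularities." Rendered:
`f` is flat, proper (hence quasi-compact and separated) and locally of finite presentation, and
for every algebraically closed field `K` and every `s̄ : Spec K → S` the geometric fibre
`X_s̄ = X ×_S Spec K` (Mathlib's `pullback f s̄`) is connected (in particular non-empty) and each
of its closed points `x` is either a nonsingular point of a curve — the local ring
`𝒪_{X_s̄,x}` is regular of dimension `1` (over the algebraically closed `K`, regular = smooth,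
loc. cit. 2.10) — or an ordinary double point (`IsOrdinaryDoublePoint`, 2.23); this forces
`X_s̄` to be a reduced curve, i.e. equidimensional of dimension `1`. This is condition (i) with
flatness, properness, reducedness, connectedness and dimension `1` of Deligne–Mumford's
Def. (1.1) of a stable curve (the stability condition (ii) and the genus (iii) are not part of
it). Same fields as `Literature.AlgebraicGeometry.Resolution.IsSemiStableCurve` (see the module
docstring). [cite: DeJong1996, 2.21, p. 61] -/
structure IsSemiStableCurve {X S : Scheme.{u}} (f : X ⟶ S) : Prop where
  /-- `f` is flat -/
  flat : Flat f
  /-- `f` is proper -/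
  isProper : IsProper f
  /-- `f` is (locally, hence — being proper — globally) of finite presentation -/
  locallyOfFinitePresentation : LocallyOfFinitePresentation f
  /-- every geometric fibre is connected (in particular non-empty) -/
  connectedSpace_pullback : ∀ (K : Type u) [Field K] [IsAlgClosed K] (s : Spec (.of K) ⟶ S),
    ConnectedSpace ↥(pullback f s)
  /-- every closed point of a geometric fibre is a nonsingular point of a curve or an ordinary
  double point -/
  isRegularLocalRing_or_isOrdinaryDoublePoint :
    ∀ (K : Type u) [Field K] [IsAlgClosed K] (s : Spec (.of K) ⟶ S) (x : ↥(pullback f s)),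
      IsClosed ({x} : Set ↥(pullback f s)) →
        (IsRegularLocalRing ((pullback f s).presheaf.stalk x) ∧
            ringKrullDim ((pullback f s).presheaf.stalk x) = 1) ∨
          IsOrdinaryDoublePoint K x

namespace IsSemiStableCurve

variable {X S : Scheme.{u}} {f : X ⟶ S}

/-- A semi-stable curve is universally open (flat and locally of finite presentation).
[folklore] -/
theorem universallyOpen (h : IsSemiStableCurve f) : UniversallyOpen f :=
  haveI := h.flat
  haveI := h.locallyOfFinitePresentation
  inferInstance

/-- A semi-stable curve is separated. [folklore] -/
theorem isSeparated (h : IsSemiStableCurve f) : IsSeparated f :=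
  haveI := h.isProper
  inferInstance

/-- A semi-stable curve over an irreducible base with non-empty source is dominant (it is an
open map). [folklore] -/
theorem isDominant (h : IsSemiStableCurve f) [IrreducibleSpace S] [Nonempty X] :
    IsDominant f := by
  haveI := h.universallyOpen
  refine ⟨?_⟩
  have ho : IsOpen (Set.range f) := f.isOpenMap.isOpen_range
  exact ho.dense (Set.range_nonempty _)

end IsSemiStableCurve

/-! ## Pointed semi-stable curves (de Jong 1996, 4.23; Knudsen 1983, Def. 1.1) -/

/-- **Pointed semi-stable curve** — the part of "stable `n`-pointed curve" (Knudsen 1983,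
Def. 1.1; de Jong 1996, 2.24) used in de Jong 1996, 4.18–4.28: `p : 𝒞 → S` is a semi-stable
curve (2.21: flat, proper, of finite presentation, geometric fibres connected with at most
ordinary double points, `IsSemiStableCurve`) and `τ₁, …, τₙ` are sections of `p` (`τᵢ ≫ p = 𝟙`)
which are mutually disjoint and land in the smooth locus of `p` (each `τᵢ(S)` lies in an open of
`𝒞` on which `p` is smooth), as in 4.23: "`τᵢ`, `1 ≤ i ≤ n` are mutually disjoint sections into
the smooth locus of `f`, i.e. `τᵢ : Y → sm(X/Y)`". The arithmetic genus and Knudsen's stability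
condition (every nonsingular rational component of a geometric fibre carries at least three
special points) are deliberately not part of the structure. Same fields as
`Literature.AlgebraicGeometry.Resolution.DeJong1996.IsPointedSemiStableCurve` (see the module
docstring). [cite: DeJong1996, 2.21 and 4.23, pp. 61, 75] -/
structure IsPointedSemiStableCurve {C S : Scheme.{u}} (p : C ⟶ S) {n : ℕ}
    (τ : Fin n → (S ⟶ C)) : Prop where
  /-- `p : 𝒞 → S` is a semi-stable curve -/
  isSemiStableCurve : IsSemiStableCurve p
  /-- the `τᵢ` are sections of `p` -/
  comp_eq_id : ∀ i, τ i ≫ p = 𝟙 S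
  /-- the sections are mutually disjoint -/
  pairwise_disjoint : Pairwise fun i j => Disjoint (Set.range (τ i)) (Set.range (τ j))
  /-- the sections map into the smooth locus of `p` -/
  exists_smooth : ∀ i, ∃ V : C.Opens, Set.range (τ i) ⊆ (V : Set C) ∧ Smooth (V.ι ≫ p)

namespace IsPointedSemiStableCurve

variable {C S : Scheme.{u}} {p : C ⟶ S} {n : ℕ} {τ : Fin n → (S ⟶ C)}

/-- A section of a separated morphism is a closed immersion: `σ ≫ f = 𝟙` is a closed immersion
and `f` is separated, so `σ` is (Mathlib's `IsClosedImmersion.of_comp`). [folklore] -/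
theorem isClosedImmersion_of_comp_eq_id {X Y : Scheme.{u}} {f : X ⟶ Y} [IsSeparated f]
    {σ : Y ⟶ X} (hσ : σ ≫ f = 𝟙 Y) : IsClosedImmersion σ :=
  haveI : IsClosedImmersion (σ ≫ f) := by rw [hσ]; infer_instance
  .of_comp σ f

/-- The sections of a pointed semi-stable curve are closed immersions (sections of the
separated `p`). [folklore] -/
theorem isClosedImmersion (h : IsPointedSemiStableCurve p τ) (i : Fin n) :
    IsClosedImmersion (τ i) :=
  haveI := h.isSemiStableCurve.isSeparated
  isClosedImmersion_of_comp_eq_id (h.comp_eq_id i)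

/-- The images `τᵢ(S)` are closed. [folklore] -/
theorem isClosed_range (h : IsPointedSemiStableCurve p τ) (i : Fin n) :
    IsClosed (Set.range (τ i)) :=
  haveI := h.isClosedImmersion i
  (τ i).isClosedEmbedding.isClosed_range

/-- The sections are injective as a family as soon as the base is non-empty (their images are
pairwise disjoint). [folklore] -/
theorem injective [Nonempty S] (h : IsPointedSemiStableCurve p τ) : Function.Injective τ := by
  intro i j hij
  by_contra hne
  have hd : Disjoint (Set.range (τ i)) (Set.range (τ j)) := h.pairwise_disjoint hne
  rw [hij] at hd
  obtain ⟨s⟩ := ‹Nonempty S›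
  exact Set.disjoint_iff.mp hd ⟨⟨s, rfl⟩, ⟨s, rfl⟩⟩

/-- A pointed semi-stable curve is flat over its base. [folklore] -/
theorem flat (h : IsPointedSemiStableCurve p τ) : Flat p :=
  h.isSemiStableCurve.flat

/-- A pointed semi-stable curve is proper over its base. [folklore] -/
theorem isProper (h : IsPointedSemiStableCurve p τ) : IsProper p :=
  h.isSemiStableCurve.isProper

end IsPointedSemiStableCurve

/-- A semi-stable curve with no marked sections is a pointed semi-stable curve (`n = 0`): the
conditions on the sections are vacuous. [folklore] -/
theorem IsSemiStableCurve.isPointedSemiStableCurve_elim {C S : Scheme.{u}} {p : C ⟶ S}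
    (h : IsSemiStableCurve p) : IsPointedSemiStableCurve p (n := 0) Fin.elim0 where
  isSemiStableCurve := h
  comp_eq_id i := i.elim0
  pairwise_disjoint i := i.elim0
  exists_smooth i := i.elim0

end Literature.AlgebraicGeometry.ModuliOfCurves

end
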